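import Mathlib
import Summits.CriticalPhenomena.CardyFormulaZ2.Theorems.CardySelfRefinementDefs
import Literature.Probability.Percolation.QuadCrossingQuadTopology
import Literature.Probability.RandomPlanarGeometry.TranslatedRectangleDomains
import HarnessLib

/-!
# Boundary-layer surgery, topology brick (L1): a quad as a Jordan domain with its sides as arcs

Helper file of the registered stub `stub_layerLocalModification` (the deterministic
boundary-layer surgery) of the line `monotone-product-coordinates` (crux
`stmt-CriticalPhenomena-10269`, `…Theses.CardySelfRefinement.GradientComparability`).  Step (S3)
of the layer surgery ("dead fingers") applies the cross-cut topology of a Jordan domain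
(`crosscut_sides_and_pockets`, file `…StubLayerCrosscutPockets.lean`) to the open quad `[Q]°`;
this file supplies the bridge between the two vocabularies:

* **`quad_exists_jordanDomain`** (registered helper): for every quad `Q` (Schramm–Smirnov,
  `QuadCrossingSpace.lean`) there is a Jordan domain `J`
  (`Literature.Probability.RandomPlanarGeometry.JordanDomain`) with `J.carrier = [Q]°`,
  `closure J.carrier = [Q]`, `frontier J.carrier = ∂[Q]`, whose boundary loop traverses the four
  sides of `Q` on the four quarter periods — `∂₁Q = J.boundary [0, ¼]`, `∂₂Q = J.boundary [¼, ½]`,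
  `∂₃Q = J.boundary [½, ¾]`, `∂₀Q = J.boundary [¾, 1]` — with the pointwise dictionary
  `J.boundary (θ/4) = Q(θ, 0)`, `J.boundary ((1+θ)/4) = Q(1, θ)`,
  `J.boundary ((2+θ)/4) = Q(1-θ, 1)`, `J.boundary ((3+θ)/4) = Q(0, 1-θ)` (`θ ∈ [0, 1]`).

Proof.  `J` is the square Jordan domain `rectDomain 1 1` (carrier `(-1,1)²`, boundary the closed
polygon through `(-1,-1), (1,-1), (1,1), (-1,1)`) pushed through the straightening homeomorphism
`H` of `Quad.exists_straighten` (`[Q] = H [-1,1]²`, `H⁻¹ (Q p) = (2p₁ - 1) + (2p₂ - 1) i`) by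
`JordanDomain.map`.  No percolation, no named fact.
-/

noncomputable section

namespace Summit.CriticalPhenomena.CardyFormulaZ2.Theorems.CardySelfRefinement

open scoped Topology
open Filter Set MeasureTheory
open Literature.Probability.LatticeModels Literature.Probability.Percolation
open Literature.Probability.Percolation.QuadCrossing
open Summit.CriticalPhenomena.CardyFormulaZ2.Theses.CardySelfRefinement
open Literature.Topology.PlaneTopology Literature.Probability.RandomPlanarGeometry

/-- The four pieces of the boundary polygon of the square `(-1,1)²`: for `θ ∈ [0, 1]` the
boundary points of parameters `θ/4`, `(1+θ)/4`, `(2+θ)/4`, `(3+θ)/4` of `rectDomain 1 1` are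
`(-1+2θ, -1)`, `(1, -1+2θ)`, `(1-2θ, 1)`, `(-1, 1-2θ)`. -/
theorem rectDomain_one_one_boundary_pieces {θ : ℝ} (hθ : θ ∈ Icc (0 : ℝ) 1) :
    (rectDomain 1 1 one_pos one_pos).boundary (θ / 4) = ⟨-1 + 2 * θ, -1⟩ ∧
    (rectDomain 1 1 one_pos one_pos).boundary ((1 + θ) / 4) = ⟨1, -1 + 2 * θ⟩ ∧
    (rectDomain 1 1 one_pos one_pos).boundary ((2 + θ) / 4) = ⟨1 - 2 * θ, 1⟩ ∧
    (rectDomain 1 1 one_pos one_pos).boundary ((3 + θ) / 4) = ⟨-1, 1 - 2 * θ⟩ := by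
  refine ⟨?_, ?_, ?_, ?_⟩
  · rw [rectDomain_boundary_bottom one_pos one_pos hθ]; simp
  · have h := polygonLoop_apply_div (l := rectVerts (1 : ℝ) 1) (k := 1) (by simp) hθ
    simp only [Nat.cast_one, length_rectVerts, Nat.cast_ofNat, Nat.reduceAdd, Nat.reduceMod] at h
    change polygonLoop (rectVerts (1 : ℝ) 1) ((1 + θ) / 4) = _
    rw [h]
    simp only [rectVerts, List.getElem_cons_zero, List.getElem_cons_succ,
      AffineMap.lineMap_apply_module']
    apply Complex.ext
    · simp
    · simp; ring
  · rw [rectDomain_boundary_top one_pos one_pos hθ]; simp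
  · have h := polygonLoop_apply_div (l := rectVerts (1 : ℝ) 1) (k := 3) (by simp) hθ
    simp only [Nat.cast_ofNat, length_rectVerts, Nat.reduceAdd, Nat.reduceMod] at h
    change polygonLoop (rectVerts (1 : ℝ) 1) ((3 + θ) / 4) = _
    rw [h]
    simp only [rectVerts, List.getElem_cons_zero, List.getElem_cons_succ,
      AffineMap.lineMap_apply_module']
    apply Complex.ext
    · simp
    · simp; ring

/-- **A quad as a Jordan domain with its sides as boundary arcs** (brick (L1) of the
boundary-layer surgery `stub_layerLocalModification`; registered helper).  For every quad `Q`
there is a Jordan domain `J` with carrier the interior `[Q]°`, closure `[Q]` and frontier `∂[Q]`,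
whose boundary loop runs through `∂₁Q, ∂₂Q, ∂₃Q, ∂₀Q` on the parameter intervals
`[0,¼], [¼,½], [½,¾], [¾,1]`, pointwise `J.boundary (θ/4) = Q(θ,0)`,
`J.boundary ((1+θ)/4) = Q(1,θ)`, `J.boundary ((2+θ)/4) = Q(1-θ,1)`,
`J.boundary ((3+θ)/4) = Q(0,1-θ)` for `θ ∈ [0,1]`. -/
theorem quad_exists_jordanDomain : ∀ (D : Set ℂ) (Q : Quad D), ∃ J : Literature.Probability.RandomPlanarGeometry.JordanDomain, J.carrier = interior Q.carrier ∧ closure J.carrier = Q.carrier ∧ Q.side 1 = J.boundary '' Set.Icc 0 (1 / 4) ∧ Q.side 2 = J.boundary '' Set.Icc (1 / 4) (1 / 2) ∧ Q.side 3 = J.boundary '' Set.Icc (1 / 2) (3 / 4) ∧ Q.side 0 = J.boundary '' Set.Icc (3 / 4) 1 ∧ frontier J.carrier = frontier Q.carrier ∧ ∀ (θ : ℝ) (h : θ ∈ Set.Icc (0 : ℝ) 1), J.boundary (θ / 4) = Q (⟨θ, h⟩, 0) ∧ J.boundary ((1 + θ) / 4) = Q (1, ⟨θ, h⟩) ∧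 J.boundary ((2 + θ) / 4) = Q (unitInterval.symm ⟨θ, h⟩, 1) ∧ J.boundary ((3 + θ) / 4) = Q (0, unitInterval.symm ⟨θ, h⟩) := by
  intro D Q
  obtain ⟨H, hsymm, hcar, -, -, -, -⟩ := Q.exists_straighten
  set J : JordanDomain := (rectDomain 1 1 one_pos one_pos).map H with hJ
  have hJcar : J.carrier = H '' symRect 1 1 := rfl
  have hJbd : ∀ t, J.boundary t = H ((rectDomain 1 1 one_pos one_pos).boundary t) := fun t => rfl
  have hHQ : ∀ p : unitInterval × unitInterval,
      H (((2 * (p.1 : ℝ) - 1 : ℝ) : ℂ) + ((2 * (p.2 : ℝ) - 1 : ℝ) : ℂ) * Complex.I) = Q p :=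
    fun p => by rw [← hsymm p, Homeomorph.apply_symm_apply]
  -- the pointwise dictionary
  have hdict : ∀ (θ : ℝ) (h : θ ∈ Set.Icc (0 : ℝ) 1), J.boundary (θ / 4) = Q (⟨θ, h⟩, 0) ∧
      J.boundary ((1 + θ) / 4) = Q (1, ⟨θ, h⟩) ∧
      J.boundary ((2 + θ) / 4) = Q (unitInterval.symm ⟨θ, h⟩, 1) ∧
      J.boundary ((3 + θ) / 4) = Q (0, unitInterval.symm ⟨θ, h⟩) := by
    intro θ h
    obtain ⟨h0, h1, h2, h3⟩ := rectDomain_one_one_boundary_pieces h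
    refine ⟨?_, ?_, ?_, ?_⟩
    · rw [hJbd, h0, ← hHQ]
      congr 1
      exact Complex.ext (by simp; ring) (by simp)
    · rw [hJbd, h1, ← hHQ]
      congr 1
      apply Complex.ext <;> simp <;> ring
    · rw [hJbd, h2, ← hHQ]
      congr 1
      apply Complex.ext <;> simp [unitInterval.coe_symm_eq] <;> ring
    · rw [hJbd, h3, ← hHQ]
      congr 1
      exact Complex.ext (by simp) (by simp [unitInterval.coe_symm_eq]; ring)
  -- carrier, closure, frontier
  have hcarJ : J.carrier = interior Q.carrier := by
    rw [hJcar, hcar, ← H.image_interior, Complex.interior_reProdIm, interior_Icc, symRect]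
  have hclJ : closure J.carrier = Q.carrier := by
    rw [hJcar, ← H.image_closure, closure_symRect one_pos one_pos, hcar]
  have hfrJ : frontier J.carrier = frontier Q.carrier := by
    rw [frontier, frontier, hclJ, J.isOpen.interior_eq, hcarJ, Q.isCompact_carrier.isClosed.closure_eq]
  refine ⟨J, hcarJ, hclJ, ?_, ?_, ?_, ?_, hfrJ, hdict⟩
  · -- side 1: parameters `[0, ¼]`
    rw [Quad.side_one_eq]
    ext w
    constructor
    · rintro ⟨p, hp, rfl⟩
      refine ⟨(p.1 : ℝ) / 4, ⟨by linarith [p.1.2.1], by linarith [p.1.2.2]⟩, ?_⟩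
      rw [(hdict p.1 p.1.2).1]
      congr 1
      exact Prod.ext rfl (by simpa using hp.symm)
    · rintro ⟨t, ht, rfl⟩
      have h4 : 4 * t ∈ Set.Icc (0 : ℝ) 1 := ⟨by linarith [ht.1], by linarith [ht.2]⟩
      refine ⟨(⟨4 * t, h4⟩, 0), rfl, ?_⟩
      rw [← (hdict (4 * t) h4).1]
      congr 1; ring
  · -- side 2: parameters `[¼, ½]`
    rw [Quad.side_two_eq]
    ext w
    constructor
    · rintro ⟨p, hp, rfl⟩
      refine ⟨(1 + (p.2 : ℝ)) / 4, ⟨by linarith [p.2.2.1], by linarith [p.2.2.2]⟩, ?_⟩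
      rw [(hdict p.2 p.2.2).2.1]
      congr 1
      exact Prod.ext (by simpa using hp.symm) rfl
    · rintro ⟨t, ht, rfl⟩
      have h4 : 4 * t - 1 ∈ Set.Icc (0 : ℝ) 1 := ⟨by linarith [ht.1], by linarith [ht.2]⟩
      refine ⟨(1, ⟨4 * t - 1, h4⟩), rfl, ?_⟩
      rw [← (hdict (4 * t - 1) h4).2.1]
      congr 1; ring
  · -- side 3: parameters `[½, ¾]`
    rw [Quad.side_three_eq]
    ext w
    constructor
    · rintro ⟨p, hp, rfl⟩
      refine ⟨(2 + (1 - (p.1 : ℝ))) / 4, ⟨by linarith [p.1.2.2], by linarith [p.1.2.1]⟩, ?_⟩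
      rw [(hdict (1 - p.1) (unitInterval.symm p.1).2).2.2.1]
      congr 1
      refine Prod.ext ?_ (by simpa using hp.symm)
      exact unitInterval.symm_symm p.1
    · rintro ⟨t, ht, rfl⟩
      have h4 : 4 * t - 2 ∈ Set.Icc (0 : ℝ) 1 := ⟨by linarith [ht.1], by linarith [ht.2]⟩
      refine ⟨(unitInterval.symm ⟨4 * t - 2, h4⟩, 1), rfl, ?_⟩
      rw [← (hdict (4 * t - 2) h4).2.2.1]
      congr 1; ring
  · -- side 0: parameters `[¾, 1]`
    rw [Quad.side_zero_eq]
    ext w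
    constructor
    · rintro ⟨p, hp, rfl⟩
      refine ⟨(3 + (1 - (p.2 : ℝ))) / 4, ⟨by linarith [p.2.2.2], by linarith [p.2.2.1]⟩, ?_⟩
      rw [(hdict (1 - p.2) (unitInterval.symm p.2).2).2.2.2]
      congr 1
      refine Prod.ext (by simpa using hp.symm) ?_
      exact unitInterval.symm_symm p.2
    · rintro ⟨t, ht, rfl⟩
      have h4 : 4 * t - 3 ∈ Set.Icc (0 : ℝ) 1 := ⟨by linarith [ht.1], by linarith [ht.2]⟩
      refine ⟨(0, unitInterval.symm ⟨4 * t - 3, h4⟩), rfl, ?_⟩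
      rw [← (hdict (4 * t - 3) h4).2.2.2]
      congr 1; ring

end Summit.CriticalPhenomena.CardyFormulaZ2.Theorems.CardySelfRefinement

end
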